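import Literature.Topology.FourManifolds.LatticeFormsPrimitiveSublatticeDiscriminant
import HarnessLib

/-!
# Huybrechts' (0.2) `disc Λ · disc Λ^⊥ = [Γ : Λ ⊕ Λ^⊥]² · disc Γ` for REFLEXIVE (e.g. alternating) forms

Layer `Literature/Topology/FourManifolds`, namespace `LinearMap.BilinForm` (dot-notation extension, as in the sibling
`LatticeForms*` files); lane `lit-hodgefound` (Track 2 foundations library), seat p09, generation 42, row g42-#10.
THEOREMS ONLY (0 definitions); no named fact, net debt 0.

`LatticeFormsPrimitiveSublatticeDiscriminant` (§10) proves Huybrechts' formula (0.2)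
`det G_Λ · det G_{Λ^⊥} = [Γ : Λ ⊕ Λ^⊥]² · det G_Γ` for a SYMMETRIC bilinear form `B` on a lattice `Γ` and a sublattice `Λ`
with `det G_Λ ≠ 0`. Its proof uses the symmetry of `B` only through REFLEXIVITY (`B(x, y) = 0 ⇔ B(y, x) = 0`): the kernel
of `x ↦ B(x, ·)|_Λ` is `Λ^⊥` and the Gram matrix of `Λ ⊕ Λ^⊥` is block diagonal. This file records the same statements
for a reflexive form (`LinearMap.IsRefl B`), in particular for an ALTERNATING form (`LinearMap.IsAlt B`, e.g. the
intersection / Lefschetz forms in odd degree), with the same proofs: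

* §1 `ker (x ↦ B(x, ·)|_Λ) = Λ^⊥` and `rk Λ + rk Λ^⊥ = rk Γ` when `B|_Λ` is nondegenerate;
* §2 the Gram matrix of `B` on `Λ × Λ^⊥` in a basis `b_Λ ⊕ b_{Λ^⊥}` is `diag(G_Λ, G_{Λ^⊥})`;
* §3 `det G_Λ · det G_{Λ^⊥} = [Γ : Λ ⊕ Λ^⊥]² · det G_Γ` over `ℤ` for `B` reflexive with `det G_Λ ≠ 0`, and its alternating
  and symmetric specialisations (the latter re-derives §10 of the sibling file).

## References

* [cite: Huybrechts2016K3, Ch. 14 §0.1 (0.2) and §0.2 Prop. 0.2] (stated for lattices, i.e. symmetric forms; the proof printed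
  there uses only `Λ₁ ⊥ Λ₂` and the finite index of `Λ₁ ⊕ Λ₂ ⊂ Λ`)
* [cite: Ebeling1994, §1.1 Prop. 1.2 (proof) and the formula `disc Γ = |Γ^*/Γ|`]
* [cite: MilnorHusemoller1973, Ch. I §3 (inner product spaces and lattices, symmetric or skew)]
-/

open Module Function
open LinearMap (BilinForm)

namespace LinearMap.BilinForm

/-! ### §1 `ker (i^* ∘ b) = Λ^⊥` and `rk Λ + rk Λ^⊥ = rk Γ` for a reflexive form -/

section Refl

variable {R : Type*} [CommRing R] {M : Type*} [AddCommGroup M] [Module R M] (B : BilinForm R M)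
  (L : Submodule R M)

/-- **`ker (x ↦ B(x, ·)|_Λ) = Λ^⊥`** for a reflexive form (`Λ^⊥ = {m | ∀ n ∈ Λ, B(n, m) = 0}` Mathlib's left-orthogonal;
for reflexive `B` it is also the right-orthogonal). [cite: Ebeling1994, §1.1 proof of Prop. 1.2] -/
theorem ker_domRestrict₂_eq_orthogonal_of_isRefl (hB : B.IsRefl) :
    LinearMap.ker (B.domRestrict₂ L) = B.orthogonal L := by
  ext x
  rw [mem_ker_domRestrict₂_iff, mem_orthogonal_iff]
  exact forall₂_congr fun y _ ↦ ⟨fun h ↦ hB _ _ h, fun h ↦ hB _ _ h⟩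

/-- For a reflexive form the left- and right-orthogonality relations to `Λ` agree: `B(x, Λ) = 0 ⇔ B(Λ, x) = 0` ("`Λ^⊥`" is
unambiguous). [cite: MilnorHusemoller1973, Ch. I §3 (orthogonal complement for symmetric or skew forms)] [cite: Ebeling1994, §1.1] -/
theorem forall_mem_apply_eq_zero_iff_mem_orthogonal_of_isRefl (hB : B.IsRefl) (x : M) :
    (∀ y ∈ L, B x y = 0) ↔ x ∈ B.orthogonal L := by
  rw [mem_orthogonal_iff]
  exact forall₂_congr fun y _ ↦ ⟨fun h ↦ hB _ _ h, fun h ↦ hB _ _ h⟩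

/-- **The kernel of `Γ → Λ^* → Λ^*/b_Λ(Λ)` is `Λ + Λ^⊥`** for a reflexive form. [cite: Ebeling1994, §1.1 proof of Prop. 1.2] -/
theorem ker_mkQ_comp_domRestrict₂_of_isRefl (hB : B.IsRefl) :
    LinearMap.ker ((LinearMap.range (B.restrict L)).mkQ ∘ₗ B.domRestrict₂ L) = L ⊔ B.orthogonal L := by
  rw [LinearMap.ker_comp, Submodule.ker_mkQ, ← map_domRestrict₂_eq_range_restrict,
    Submodule.comap_map_eq, ker_domRestrict₂_eq_orthogonal_of_isRefl B L hB]

end Refl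

section RankRefl

variable {R : Type*} [CommRing R] [IsDomain R] [IsPrincipalIdealRing R] {M : Type*} [AddCommGroup M]
  [Module R M] (B : BilinForm R M) (L : Submodule R M)

/-- **`rk Λ + rk Λ^⊥ = rk Γ` whenever `B|_Λ` is nondegenerate**, for a REFLEXIVE form on a finitely generated free module over
a PID: `Γ/Λ^⊥` embeds in `Λ^*` by `x ↦ B(x, ·)|_Λ` and contains the full-rank image `b_Λ(Λ)`.
[cite: Huybrechts2016K3, Ch. 14 §0.1 ("the induced embedding `Λ₁ ⊕ Λ₂ ↪ Λ` is of finite index")] -/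
theorem finrank_add_finrank_orthogonal_of_nondegenerate_of_isRefl [Module.Finite R M] [Module.Free R M]
    (hB : B.IsRefl) (hnd : (B.restrict L).Nondegenerate) :
    finrank R L + finrank R (B.orthogonal L) = finrank R M := by
  classical
  have hinj : Injective (B.restrict L) :=
    LinearMap.ker_eq_bot.1 (LinearMap.separatingLeft_iff_ker_eq_bot.1 hnd.1)
  have h1 := Submodule.finrank_quotient_add_finrank (LinearMap.ker (B.domRestrict₂ L))
  rw [(B.domRestrict₂ L).quotKerEquivRange.finrank_eq, ker_domRestrict₂_eq_orthogonal_of_isRefl B L hB] at h1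
  have hle : finrank R (LinearMap.range (B.domRestrict₂ L)) ≤ finrank R L := by
    rw [(Module.Free.chooseBasis R L).toDualEquiv.finrank_eq]
    exact Submodule.finrank_le _
  have hge : finrank R L ≤ finrank R (LinearMap.range (B.domRestrict₂ L)) := by
    rw [← LinearMap.finrank_range_of_inj hinj, ← map_domRestrict₂_eq_range_restrict]
    exact Submodule.finrank_mono LinearMap.map_le_range
  omega

end RankRefl

/-! ### §2 The Gram matrix of `Λ ⊕ Λ^⊥` is block diagonal -/

section BlockRefl

variable {M : Type*} [AddCommGroup M] (B : BilinForm ℤ M) (L : Submodule ℤ M)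

/-- The Gram matrix of a REFLEXIVE `B` pulled back to `Λ × Λ^⊥` along `(l, n) ↦ l + n`, in the basis `b_Λ ⊕ b_{Λ^⊥}`, is block
diagonal `diag(G_Λ, G_{Λ^⊥})`. [cite: Ebeling1994, §1.1 (orthogonal direct sum) and Prop. 1.2] [cite: Huybrechts2016K3, Ch. 14 §0.2] -/
theorem toMatrix_comp_coprod_prod_of_isRefl (hB : B.IsRefl) {κ κ' : Type*} [Fintype κ] [DecidableEq κ]
    [Fintype κ'] [DecidableEq κ'] (bL : Basis κ ℤ L) (bN : Basis κ' ℤ (B.orthogonal L)) :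
    BilinForm.toMatrix (bL.prod bN)
        (B.comp (L.subtype.coprod (B.orthogonal L).subtype) (L.subtype.coprod (B.orthogonal L).subtype)) =
      Matrix.fromBlocks (BilinForm.toMatrix bL (B.restrict L)) 0 0
        (BilinForm.toMatrix bN (B.restrict (B.orthogonal L))) := by
  have hLN : ∀ (i : κ) (j : κ'), B (bL i) (bN j) = 0 := fun i j ↦
    (mem_orthogonal_iff.1 (bN j).2) _ (bL i).2
  have hNL : ∀ (i : κ) (j : κ'), B (bN j) (bL i) = 0 := fun i j ↦ hB _ _ (hLN i j)
  ext (i | i) (j | j)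
  · rw [BilinForm.toMatrix_apply, Matrix.fromBlocks_apply₁₁, BilinForm.toMatrix_apply, comp_apply]
    simp [LinearMap.coprod_apply]
  · rw [BilinForm.toMatrix_apply, Matrix.fromBlocks_apply₁₂, comp_apply]
    simp [LinearMap.coprod_apply, hLN]
  · rw [BilinForm.toMatrix_apply, Matrix.fromBlocks_apply₂₁, comp_apply]
    simp [LinearMap.coprod_apply, hNL]
  · rw [BilinForm.toMatrix_apply, Matrix.fromBlocks_apply₂₂, BilinForm.toMatrix_apply, comp_apply]
    simp [LinearMap.coprod_apply]

end BlockRefl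

/-! ### §3 Huybrechts' (0.2) for a reflexive form on an arbitrary lattice -/

section IndexRefl

variable {M : Type*} [AddCommGroup M] (B : BilinForm ℤ M) (L : Submodule ℤ M)

/-- **Huybrechts' (0.2) "`disc Λ₁ · disc Λ₂ = disc Λ · (Λ : Λ₁ ⊕ Λ₂)²`" for a REFLEXIVE form** (`Λ₂ = Λ₁^⊥`; `B` reflexive —
e.g. symmetric or alternating — on the lattice `Γ`, not necessarily unimodular or nondegenerate, `Λ₁` not necessarily primitive),
as soon as `det G_{Λ₁} ≠ 0`; arbitrary `ℤ`-bases `b_Γ`, `b_{Λ₁}`, `b_{Λ₂}`. Same proof as the symmetric case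
(`det_mul_det_orthogonal_eq_index_sq_mul_of_det_ne_zero`): `Λ ⊕ Λ^⊥ ↪ Γ` has full rank, its Gram matrix is
`diag(G_Λ, G_{Λ^⊥}) = Aᵀ G_Γ A` with `|det A| = [Γ : Λ ⊕ Λ^⊥]`. [cite: Huybrechts2016K3, Ch. 14 §0.1 (0.2)] [cite: MilnorHusemoller1973, Ch. I §3] -/
theorem det_mul_det_orthogonal_eq_index_sq_mul_of_det_ne_zero_of_isRefl [Module.Finite ℤ M] [Module.Free ℤ M]
    (hB : B.IsRefl) {ι κ κ' : Type*} [Fintype ι] [DecidableEq ι] [Fintype κ] [DecidableEq κ]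
    [Fintype κ'] [DecidableEq κ'] (bM : Basis ι ℤ M) (bL : Basis κ ℤ L)
    (bN : Basis κ' ℤ (B.orthogonal L)) (hdet : (BilinForm.toMatrix bL (B.restrict L)).det ≠ 0) :
    (BilinForm.toMatrix bL (B.restrict L)).det * (BilinForm.toMatrix bN (B.restrict (B.orthogonal L))).det =
      ((L ⊔ B.orthogonal L).toAddSubgroup.index : ℤ) ^ 2 * (BilinForm.toMatrix bM B).det := by
  classical
  have hnd : (B.restrict L).Nondegenerate := (nondegenerate_iff_det_ne_zero bL).2 hdet
  -- reindex `b_Γ` by `κ ⊕ κ'` (`rk Λ + rk Λ^⊥ = rk Γ`)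
  have hcard : Fintype.card (κ ⊕ κ') = Fintype.card ι := by
    rw [Fintype.card_sum, ← finrank_eq_card_basis bL, ← finrank_eq_card_basis bN,
      ← finrank_eq_card_basis bM, finrank_add_finrank_orthogonal_of_nondegenerate_of_isRefl B L hB hnd]
  let eι : κ ⊕ κ' ≃ ι := Fintype.equivOfCardEq hcard
  let bM' : Basis (κ ⊕ κ') ℤ M := bM.reindex eι.symm
  have hGM : (BilinForm.toMatrix bM' B).det = (BilinForm.toMatrix bM B).det := by
    have h : BilinForm.toMatrix bM' B = Matrix.reindex eι.symm eι.symm (BilinForm.toMatrix bM B) := by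
      ext i j
      rw [BilinForm.toMatrix_apply, Matrix.reindex_apply, Matrix.submatrix_apply,
        BilinForm.toMatrix_apply, Basis.reindex_apply, Basis.reindex_apply, Equiv.symm_symm]
    rw [h, Matrix.det_reindex_self]
  -- the sum map `Λ × Λ^⊥ → Γ`
  set f := L.subtype.coprod (B.orthogonal L).subtype with hf
  have hfinj : Injective f := injective_coprod_subtype_orthogonal B L hnd
  have hrange : LinearMap.range f = L ⊔ B.orthogonal L := by
    rw [hf, LinearMap.range_coprod, Submodule.range_subtype, Submodule.range_subtype]
  have h1 := toMatrix_comp_coprod_prod_of_isRefl B L hB bL bN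
  rw [← hf] at h1
  have h2 : BilinForm.toMatrix (bL.prod bN) (B.comp f f) =
      (LinearMap.toMatrix (bL.prod bN) bM' f).transpose * BilinForm.toMatrix bM' B *
        LinearMap.toMatrix (bL.prod bN) bM' f :=
    LinearMap.BilinForm.toMatrix_comp bM' (bL.prod bN) B f f
  have hA : ((LinearMap.toMatrix (bL.prod bN) bM' f).det.natAbs : ℤ) =
      (L ⊔ B.orthogonal L).toAddSubgroup.index := by
    rw [← hrange]
    have h4 : (LinearMap.range f).toAddSubgroup.index = (LinearMap.toMatrix (bL.prod bN) bM' f).det.natAbs := by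
      have hbR : ∀ i, ((((bL.prod bN).map (LinearEquiv.ofInjective f hfinj)) i : LinearMap.range f) : M) =
          f ((bL.prod bN) i) := fun i ↦ by
        rw [Basis.map_apply, LinearEquiv.ofInjective_apply]
      rw [AddSubgroup.index_eq_natAbs_det bM' (LinearMap.range f).toAddSubgroup
        ((bL.prod bN).map (LinearEquiv.ofInjective f hfinj)), Basis.det_apply]
      congr 2
      ext i j
      rw [Basis.toMatrix_apply, LinearMap.toMatrix_apply]
      exact congrArg (fun v ↦ bM'.repr v i) (hbR j)
    rw [h4]
  have h3 := congrArg Matrix.det (h1.symm.trans h2)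
  rw [Matrix.det_fromBlocks_zero₂₁, Matrix.det_mul, Matrix.det_mul, Matrix.det_transpose, hGM] at h3
  rw [h3, ← hA, Int.natAbs_sq]
  ring

/-- **Huybrechts' (0.2) for an ALTERNATING form** (`B(x, x) = 0`, e.g. an intersection or Lefschetz form in odd degree):
`det G_Λ · det G_{Λ^⊥} = [Γ : Λ ⊕ Λ^⊥]² · det G_Γ` as soon as `det G_Λ ≠ 0`. [cite: Huybrechts2016K3, Ch. 14 §0.1 (0.2)] [cite: MilnorHusemoller1973, Ch. I §3] -/
theorem det_mul_det_orthogonal_eq_index_sq_mul_of_det_ne_zero_of_isAlt [Module.Finite ℤ M] [Module.Free ℤ M]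
    (hB : B.IsAlt) {ι κ κ' : Type*} [Fintype ι] [DecidableEq ι] [Fintype κ] [DecidableEq κ]
    [Fintype κ'] [DecidableEq κ'] (bM : Basis ι ℤ M) (bL : Basis κ ℤ L)
    (bN : Basis κ' ℤ (B.orthogonal L)) (hdet : (BilinForm.toMatrix bL (B.restrict L)).det ≠ 0) :
    (BilinForm.toMatrix bL (B.restrict L)).det * (BilinForm.toMatrix bN (B.restrict (B.orthogonal L))).det =
      ((L ⊔ B.orthogonal L).toAddSubgroup.index : ℤ) ^ 2 * (BilinForm.toMatrix bM B).det :=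
  det_mul_det_orthogonal_eq_index_sq_mul_of_det_ne_zero_of_isRefl B L hB.isRefl bM bL bN hdet

/-- **`|disc Λ| · |disc Λ^⊥| = [Γ : Λ ⊕ Λ^⊥]² · |disc Γ|` in natural numbers**, for a reflexive form with `det G_Λ ≠ 0`.
[cite: Huybrechts2016K3, Ch. 14 §0.1 (0.2)] -/
theorem natAbs_det_mul_natAbs_det_orthogonal_eq_index_sq_mul_of_isRefl [Module.Finite ℤ M] [Module.Free ℤ M]
    (hB : B.IsRefl) {ι κ κ' : Type*} [Fintype ι] [DecidableEq ι] [Fintype κ] [DecidableEq κ]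
    [Fintype κ'] [DecidableEq κ'] (bM : Basis ι ℤ M) (bL : Basis κ ℤ L)
    (bN : Basis κ' ℤ (B.orthogonal L)) (hdet : (BilinForm.toMatrix bL (B.restrict L)).det ≠ 0) :
    (BilinForm.toMatrix bL (B.restrict L)).det.natAbs * (BilinForm.toMatrix bN (B.restrict (B.orthogonal L))).det.natAbs =
      (L ⊔ B.orthogonal L).toAddSubgroup.index ^ 2 * (BilinForm.toMatrix bM B).det.natAbs := by
  have h := congrArg Int.natAbs (det_mul_det_orthogonal_eq_index_sq_mul_of_det_ne_zero_of_isRefl B L hB bM bL bN hdet)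
  rwa [Int.natAbs_mul, Int.natAbs_mul, Int.natAbs_pow, Int.natAbs_natCast] at h

end IndexRefl

end LinearMap.BilinForm
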